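import Summits.QuantumAdvantage.AdviceFreeQNC0.CrossTeamRectangles
import Summits.QuantumAdvantage.AdviceFreeQNC0.LevelSetResidueBalance
import Summits.QuantumAdvantage.AdviceFreeQNC0.CubeTransfer
import HarnessLib

/-!
# Cell qa-qnc0 (rung F-Q1, route RingFrame, crux α `RingToElim`): the rectangle mechanism, first case,
# mirror form — a cross team whose FIRST member is cross-free loses a constant fraction of cells

Companion of `CrossTeamHalfFree.lean` (prover qn-prover-3 gen 7) with the roles of the two members
exchanged: team 0 (own block `u ∈ {0,1}^L`) is CROSS-FREE (`F₀ u v` does not depend on `v`; arbitrary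
in `u`), team 1 (own block `v ∈ {0,1}^{L'}`, `L' ≥ 2`) is arbitrary in `v` with cross-degree `≤ d` in
`u`, in the Viola–Wigderson regime `16·4^d ≤ L`.  Row-constancy of good rectangles is then automatic
and column-constancy is counted through the atoms of team 1's six Boolean coordinates on `U`
(`atom_class_ge`):

* `card_colConst_triples_ge` — for any three columns `v⃗`, at least `(2^L/384)³` transversal row
  triples `u⃗` (`|u_i| ≡ i`) have `F₁ (v j) (u i)` independent of `i` for each `j`;
* **`crossWin_loss_of_crossFree_left`** — `2^{L+L'} ≤ 9·216·384³ · #LOST` (every charge);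
* **`ringWinU_fail_of_crossFree_left`** — walk form: a walk strategy on `L + L'` bits whose cuts
  `g < L` do not read the SECOND block and whose cuts `g ≥ L` read the first block through polynomials
  of degree `≤ d` for each fixed content of the second block fails on `≥ 2^{L+L'}/(9·216·384³)` inputs.

Together with `ringWinU_fail_of_crossFree_right`: **if the cuts of EITHER block are blind to the other
block, the strategy fails on a `9·10⁻¹²` fraction of the inputs, whatever its dependence on the own
blocks, as soon as the sighted side's cross-degree `d` has `16·4^d ≤` the blind block's length.**
The cell's statement (prover qn-prover-3 gen 7, 2026-08-27); not in print.  WHAT THIS IS NOT: nothing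
for totally sighted strategies (`GoodRectangleDensity` open); α untouched; separation NOT moved.
-/

noncomputable section

namespace Summit.QuantumAdvantage.AdviceFreeQNC0

open Finset
open Literature.Computability.MetaComplexity Literature.Computability.MetaComplexity.Smolensky

variable {L L' : ℕ}

/-! ### Team 1's side: many transversal row triples on which three given columns are constant -/

/-- **Column-constant transversal row triples.**  For any three columns `v⃗` of a profile `F₁` of
cross-degree `≤ d` (in `u`) with `L ≥ 16·4^d`, at least `(2^L/384)³` row triples `u⃗` with
`|u_i| ≡ i (mod 3)` have `F₁ (v j) (u i)` independent of `i` for each `j`. -/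
theorem card_colConst_triples_ge {d : ℕ} (F₁ : (Fin L' → Bool) → (Fin L → Bool) → T4)
    (hF₁ : CrossDeg d F₁) (hL : 16 * 4 ^ d ≤ L) (v : Fin 3 → (Fin L' → Bool)) :
    ((2 : ℝ) ^ L / 384) ^ 3 ≤
      ((univ.filter fun u : Fin 3 → (Fin L → Bool) =>
        (∀ i, wt (u i) % 3 = i.val) ∧ (∀ i j, F₁ (v j) (u i) = F₁ (v j) (u 0))).card : ℝ) := by
  classical
  -- the six Boolean coordinates of the three columns
  set φ : Fin 6 → (Fin L → Bool) → Bool := fun k u =>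
    if k.val % 2 = 0 then (F₁ (v ⟨k.val / 2, by omega⟩) u).1
    else (F₁ (v ⟨k.val / 2, by omega⟩) u).2 with hφdef
  have hφ : ∀ k, HasDeg (φ k) d := by
    intro k
    by_cases hk : k.val % 2 = 0
    · have e : φ k = fun u => (F₁ (v ⟨k.val / 2, by omega⟩) u).1 := by
        funext u; simp only [hφdef, hk, if_true]
      rw [e]; exact (hF₁ _).1
    · have e : φ k = fun u => (F₁ (v ⟨k.val / 2, by omega⟩) u).2 := by
        funext u; simp only [hφdef, hk, if_false]
      rw [e]; exact (hF₁ _).2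
  -- same atom ⇒ same values in the three columns
  have hsame : ∀ u u' : Fin L → Bool, (fun k => φ k u) = (fun k => φ k u') →
      ∀ j : Fin 3, F₁ (v j) u = F₁ (v j) u' := by
    intro u u' h j
    have h1 := congrFun h ⟨2 * j.val, by omega⟩
    have h2 := congrFun h ⟨2 * j.val + 1, by omega⟩
    have e1 : (⟨(2 * j.val) / 2, by omega⟩ : Fin 3) = j := Fin.ext (by simp)
    have e2 : (⟨(2 * j.val + 1) / 2, by omega⟩ : Fin 3) = j := Fin.ext (by simp; omega)
    have hm1 : (2 * j.val) % 2 = 0 := by omega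
    have hm2 : ¬ (2 * j.val + 1) % 2 = 0 := by omega
    simp only [hφdef, hm1, hm2, if_true, if_false, e1, e2] at h1 h2
    exact Prod.ext h1 h2
  -- the atoms and the largest one
  set A : (Fin 6 → Bool) → Finset (Fin L → Bool) := fun α =>
    univ.filter fun u => (fun k => φ k u) = α with hA
  have hsum : ∑ α : Fin 6 → Bool, ((A α).card : ℝ) = (2 : ℝ) ^ L := by
    have h := Finset.card_eq_sum_card_fiberwise (s := (univ : Finset (Fin L → Bool)))
      (t := (univ : Finset (Fin 6 → Bool))) (f := fun u k => φ k u) (fun _ _ => mem_univ _)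
    rw [card_univ, Fintype.card_fun, Fintype.card_bool, Fintype.card_fin] at h
    have h' : ((2 ^ L : ℕ) : ℝ) = ∑ α : Fin 6 → Bool, ((A α).card : ℝ) := by
      rw [h]; push_cast; rfl
    rw [← h']; push_cast; rfl
  obtain ⟨α, -, hα⟩ : ∃ α ∈ (univ : Finset (Fin 6 → Bool)), (2 : ℝ) ^ L / 64 ≤ ((A α).card : ℝ) := by
    refine Finset.exists_le_of_sum_le univ_nonempty ?_
    rw [hsum, sum_const, card_univ, Fintype.card_fun, Fintype.card_bool, Fintype.card_fin]
    norm_num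
    exact le_of_eq (by ring)
  -- every residue class meets the largest atom in `≥ 2^L/384` points
  have hvw : vwErr L d ≤ 1 / 256 := by
    have h := two_pow_mul_vwErr_le (K := 5) (d := d) (L := L) (by omega)
    have : (2 : ℝ) ^ 5 = 32 := by norm_num
    rw [this] at h
    linarith
  have hcls : ∀ i : Fin 3, (2 : ℝ) ^ L / 384 ≤
      (((A α).filter fun u => wt u % 3 = i.val % 3).card : ℝ) := by
    intro i
    have h := atom_class_ge φ hφ α i.val
    have h2 : (0 : ℝ) ≤ (2 : ℝ) ^ L := by positivity
    have h3 : 2 / 3 * ((2 : ℝ) ^ L * vwErr L d) ≤ (2 : ℝ) ^ L / 384 := by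
      have := mul_le_mul_of_nonneg_left hvw h2
      linarith
    have h4 : (2 : ℝ) ^ L / 192 ≤ ((A α).card : ℝ) / 3 := by linarith
    exact le_trans (by linarith) h
  -- the box of such triples
  set T : Finset (Fin 3 → (Fin L → Bool)) :=
    Fintype.piFinset fun i : Fin 3 => (A α).filter fun u => wt u % 3 = i.val % 3 with hT
  have hTsub : T ⊆ univ.filter fun u : Fin 3 → (Fin L → Bool) =>
      (∀ i, wt (u i) % 3 = i.val) ∧ (∀ i j, F₁ (v j) (u i) = F₁ (v j) (u 0)) := by
    intro u hu
    rw [hT, Fintype.mem_piFinset] at hu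
    have hu' : ∀ i, u i ∈ A α ∧ wt (u i) % 3 = i.val % 3 := fun i => by
      have := hu i; rwa [mem_filter] at this
    rw [mem_filter]
    refine ⟨mem_univ _, fun i => ?_, fun i j => ?_⟩
    · rw [(hu' i).2]; exact Nat.mod_eq_of_lt i.isLt
    · have hi := (hu' i).1
      have h0 := (hu' 0).1
      rw [hA, mem_filter] at hi h0
      exact hsame (u i) (u 0) (hi.2.trans h0.2.symm) j
  have hTcard : ((2 : ℝ) ^ L / 384) ^ 3 ≤ (T.card : ℝ) := by
    rw [hT, Fintype.card_piFinset]
    push_cast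
    calc ((2 : ℝ) ^ L / 384) ^ 3 = ∏ _i : Fin 3, (2 : ℝ) ^ L / 384 := by
          rw [prod_const, card_univ, Fintype.card_fin]
      _ ≤ ∏ i : Fin 3, (((A α).filter fun u => wt u % 3 = i.val % 3).card : ℝ) :=
          prod_le_prod (fun _ _ => by positivity) (fun i _ => hcls i)
  exact hTcard.trans (by exact_mod_cast card_le_card hTsub)

/-! ### The loss bound -/

/-- **A cross team whose first member is cross-free loses a constant fraction of the cells.**
Team 0: its profile does not depend on `v`; team 1: arbitrary in its own block `v ∈ {0,1}^{L'}`
(`L' ≥ 2`), cross-degree `≤ d` in `u`; `L ≥ 16·4^d`.  Then `2^{L+L'} ≤ 9·216·384³ · #{lost cells}`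
for every charge `c`. -/
theorem crossWin_loss_of_crossFree_left {d : ℕ} (c : ℕ)
    (F₀ : (Fin L → Bool) → (Fin L' → Bool) → T4) (F₁ : (Fin L' → Bool) → (Fin L → Bool) → T4)
    (hF₀ : ∀ u v v', F₀ u v = F₀ u v') (hF₁ : CrossDeg d F₁) (hL : 16 * 4 ^ d ≤ L) (hL' : 2 ≤ L') :
    (2 : ℝ) ^ (L + L') ≤ 9 * 216 * 384 ^ 3 *
      ((univ.filter fun p : (Fin L → Bool) × (Fin L' → Bool) => crossWin c F₀ F₁ p.1 p.2 = false).card : ℝ) := by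
  classical
  -- the good rectangles of the parity obstruction
  set G := (univ : Finset ((Fin 3 → (Fin L → Bool)) × (Fin 3 → (Fin L' → Bool)))).filter fun R =>
      (∀ i, wt (R.1 i) % 3 = i.val) ∧ (∀ j, wt (R.2 j) % 3 = j.val) ∧
        (∀ i j, F₀ (R.1 i) (R.2 j) = F₀ (R.1 i) (R.2 0)) ∧
          (∀ i j, F₁ (R.2 j) (R.1 i) = F₁ (R.2 j) (R.1 0)) with hG
  have hrect := card_goodRectangles_le c F₀ F₁
  -- transversal column triples and, for each, the column-constant row triples
  set S : Finset (Fin 3 → (Fin L' → Bool)) := Fintype.piFinset fun j : Fin 3 => cls L' j.val with hS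
  set Tu : (Fin 3 → (Fin L' → Bool)) → Finset (Fin 3 → (Fin L → Bool)) := fun v =>
    univ.filter fun u : Fin 3 → (Fin L → Bool) =>
      (∀ i, wt (u i) % 3 = i.val) ∧ (∀ i j, F₁ (v j) (u i) = F₁ (v j) (u 0)) with hTu
  set W := (S.sigma Tu).map ((Equiv.sigmaEquivProd (Fin 3 → (Fin L' → Bool))
    (Fin 3 → (Fin L → Bool))).trans (Equiv.prodComm _ _)).toEmbedding with hW
  have hWsub : W ⊆ G := by
    intro R hR
    rw [hW, mem_map] at hR
    obtain ⟨⟨v, u⟩, hvu, rfl⟩ := hR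
    rw [mem_sigma] at hvu
    obtain ⟨hv, hu⟩ := hvu
    rw [hS, Fintype.mem_piFinset] at hv
    rw [hTu, mem_filter] at hu
    rw [hG, mem_filter]
    simp only [Equiv.toEmbedding_apply, Equiv.trans_apply, Equiv.sigmaEquivProd_apply,
      Equiv.prodComm_apply, Prod.swap_prod_mk]
    refine ⟨mem_univ _, hu.2.1, fun j => ?_, fun i j => hF₀ _ _ _, hu.2.2⟩
    have := hv j
    unfold cls at this
    rw [mem_filter] at this
    rw [this.2]
    exact Nat.mod_eq_of_lt j.isLt
  have hWcard : (W.card : ℝ) = ∑ v ∈ S, ((Tu v).card : ℝ) := by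
    rw [hW, card_map, card_sigma]
    push_cast
    rfl
  -- sizes
  have hScard : ((2 : ℝ) ^ L' / 6) ^ 3 ≤ (S.card : ℝ) := by
    rw [hS, Fintype.card_piFinset]
    push_cast
    have h4 : (4 : ℝ) ≤ (2 : ℝ) ^ L' := by
      have : (2 : ℝ) ^ 2 ≤ (2 : ℝ) ^ L' := pow_le_pow_right₀ (by norm_num) hL'
      norm_num at this
      exact this
    have hcl : ∀ j : Fin 3, (2 : ℝ) ^ L' / 6 ≤ ((cls L' j.val).card : ℝ) := by
      intro j
      have := three_mul_card_cls_ge L' j.val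
      linarith
    calc ((2 : ℝ) ^ L' / 6) ^ 3 = ∏ _j : Fin 3, (2 : ℝ) ^ L' / 6 := by
          rw [prod_const, card_univ, Fintype.card_fin]
      _ ≤ ∏ j : Fin 3, ((cls L' j.val).card : ℝ) :=
          prod_le_prod (fun _ _ => by positivity) (fun j _ => hcl j)
  have hTucard : ∀ v, ((2 : ℝ) ^ L / 384) ^ 3 ≤ ((Tu v).card : ℝ) := fun v =>
    card_colConst_triples_ge F₁ hF₁ hL v
  have hGcard : ((2 : ℝ) ^ L' / 6) ^ 3 * ((2 : ℝ) ^ L / 384) ^ 3 ≤ (G.card : ℝ) := by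
    have h1 : (S.card : ℝ) * ((2 : ℝ) ^ L / 384) ^ 3 ≤ (W.card : ℝ) := by
      rw [hWcard]
      have := Finset.sum_le_sum fun v (_ : v ∈ S) => hTucard v
      rw [sum_const, nsmul_eq_mul] at this
      exact this
    have h2 : (W.card : ℝ) ≤ (G.card : ℝ) := by exact_mod_cast card_le_card hWsub
    have h3 : (0 : ℝ) ≤ ((2 : ℝ) ^ L / 384) ^ 3 := by positivity
    nlinarith
  -- assemble
  have hrect' : (G.card : ℝ) ≤ 9 * ((4 : ℝ) ^ L * 4 ^ L' *
      ((univ.filter fun p : (Fin L → Bool) × (Fin L' → Bool) => crossWin c F₀ F₁ p.1 p.2 = false).card : ℝ)) := by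
    exact_mod_cast hrect
  set LOST := ((univ.filter fun p : (Fin L → Bool) × (Fin L' → Bool) =>
    crossWin c F₀ F₁ p.1 p.2 = false).card : ℝ) with hLOST
  have h4L : (4 : ℝ) ^ L = 2 ^ L * 2 ^ L := by rw [← mul_pow]; norm_num
  have h4L' : (4 : ℝ) ^ L' = 2 ^ L' * 2 ^ L' := by rw [← mul_pow]; norm_num
  have hpos : (0 : ℝ) < (2 : ℝ) ^ L * 2 ^ L * (2 ^ L' * 2 ^ L') := by positivity
  have key : (2 : ℝ) ^ L * 2 ^ L * (2 ^ L' * 2 ^ L') * (2 ^ L * 2 ^ L') ≤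
      (2 : ℝ) ^ L * 2 ^ L * (2 ^ L' * 2 ^ L') * (9 * 216 * 384 ^ 3 * LOST) := by
    have := hGcard.trans hrect'
    rw [h4L, h4L'] at this
    nlinarith [this]
  rw [pow_add]
  exact le_of_mul_le_mul_left key hpos

/-! ### The walk-game form -/

/-- A masked Boolean function `f ∧ b` has the degree of `f`. -/
private theorem halfFreeLeft_hasDeg_and {k : ℕ} {f : (Fin k → Bool) → Bool} {D : ℕ} (hf : HasDeg f D)
    (b : Bool) : HasDeg (fun x => f x && b) D := by
  cases b
  · have : (fun x => f x && false) = fun _ : Fin k → Bool => false := by funext x; simp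
    rw [this]; exact hasDeg_false D
  · have : (fun x => f x && true) = f := by funext x; simp
    rw [this]; exact hf

/-- The first coordinate of a masked `ω`-power term. -/
private theorem halfFreeLeft_ite_fst (b : Bool) (m : ℕ) :
    (if b = true then tOmegaPow m (true, false) else ((false, false) : T4)).1 =
      (b && (tOmegaPow m (true, false)).1) := by
  cases b <;> simp

/-- The second coordinate of a masked `ω`-power term. -/
private theorem halfFreeLeft_ite_snd (b : Bool) (m : ℕ) :
    (if b = true then tOmegaPow m (true, false) else ((false, false) : T4)).2 =
      (b && (tOmegaPow m (true, false)).2) := by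
  cases b <;> simp

/-- Team 1's profile has cross-degree `≤ d` as soon as every second-block cut reads the first block
through a polynomial of degree `≤ d` for each fixed content of the second block. -/
theorem crossDeg_F1_of_left_deg {d : ℕ} (y : Fin (L + L' + 1) → (Fin (L + L') → Bool) → Bool)
    (hy : ∀ g : Fin (L + L' + 1), ¬ g.val < L → ∀ v : Fin L' → Bool,
      HasDeg (fun u : Fin L → Bool => y g (Fin.append u v)) d) :
    CrossDeg d (F1 y) := by
  intro v
  constructor
  · have heq : (fun u => (F1 y v u).1) = fun u => decide (((univ.filter fun g : Fin (L + L' + 1) =>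
        ¬ g.val < L).filter fun g => (y g (Fin.append u v) &&
          (tOmegaPow (g.val + wtPrefix v (g.val - L)) (true, false)).1) = true).card % 2 = 1) := by
      funext u
      unfold F1 t4sum
      simp only [halfFreeLeft_ite_fst]
    rw [heq]
    exact hasDeg_parity _ _ fun g hg => halfFreeLeft_hasDeg_and (hy g (mem_filter.1 hg).2 v) _
  · have heq : (fun u => (F1 y v u).2) = fun u => decide (((univ.filter fun g : Fin (L + L' + 1) =>
        ¬ g.val < L).filter fun g => (y g (Fin.append u v) &&
          (tOmegaPow (g.val + wtPrefix v (g.val - L)) (true, false)).2) = true).card % 2 = 1) := by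
      funext u
      unfold F1 t4sum
      simp only [halfFreeLeft_ite_snd]
    rw [heq]
    exact hasDeg_parity _ _ fun g hg => halfFreeLeft_hasDeg_and (hy g (mem_filter.1 hg).2 v) _

/-- Team 0's profile does not depend on the second block when no cut `g < L` reads it. -/
theorem F0_eq_of_right_blind (y : Fin (L + L' + 1) → (Fin (L + L') → Bool) → Bool)
    (hy : ∀ g : Fin (L + L' + 1), g.val < L → ∀ (u : Fin L → Bool) (v v' : Fin L' → Bool),
      y g (Fin.append u v) = y g (Fin.append u v'))
    (u : Fin L → Bool) (v v' : Fin L' → Bool) : F0 y u v = F0 y u v' := by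
  unfold F0
  refine t4sum_congr _ fun g hg => ?_
  rw [hy g (mem_filter.1 hg).2 u v v']

/-- **Walk-game form (mirror).**  A charge-`c` walk strategy on `L + L'` bits (`L ≥ 16·4^d`, `L' ≥ 2`)
whose cuts `g < L` do not read the second block, and whose cuts `g ≥ L` read the first block through
polynomials of degree `≤ d` for each fixed content of the second block, FAILS on at least
`2^{L+L'}/(9·216·384³)` inputs. -/
theorem ringWinU_fail_of_crossFree_left {d : ℕ} (c : ℕ)
    (y : Fin (L + L' + 1) → (Fin (L + L') → Bool) → Bool)
    (hyA : ∀ g : Fin (L + L' + 1), g.val < L → ∀ (u : Fin L → Bool) (v v' : Fin L' → Bool),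
      y g (Fin.append u v) = y g (Fin.append u v'))
    (hyB : ∀ g : Fin (L + L' + 1), ¬ g.val < L → ∀ v : Fin L' → Bool,
      HasDeg (fun u : Fin L → Bool => y g (Fin.append u v)) d)
    (hL : 16 * 4 ^ d ≤ L) (hL' : 2 ≤ L') :
    (2 : ℝ) ^ (L + L') ≤ 9 * 216 * 384 ^ 3 *
      ((univ.filter fun w : Fin (L + L') → Bool => ringWinU c y w = false).card : ℝ) := by
  classical
  have h := crossWin_loss_of_crossFree_left c (F0 y) (F1 y) (F0_eq_of_right_blind y hyA)
    (crossDeg_F1_of_left_deg y hyB) hL hL'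
  refine h.trans (mul_le_mul_of_nonneg_left ?_ (by norm_num))
  -- lost cells ↦ failing inputs, injectively via `Fin.append`
  have hinj : Function.Injective fun p : (Fin L → Bool) × (Fin L' → Bool) => Fin.append p.1 p.2 := by
    intro p q hpq
    have h1 : p.1 = q.1 := by
      funext i
      have := congrFun hpq (Fin.castAdd L' i)
      simpa [Fin.append_left] using this
    have h2 : p.2 = q.2 := by
      funext i
      have := congrFun hpq (Fin.natAdd L i)
      simpa [Fin.append_right] using this
    exact Prod.ext h1 h2
  have hle : (univ.filter fun p : (Fin L → Bool) × (Fin L' → Bool) =>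
      crossWin c (F0 y) (F1 y) p.1 p.2 = false).card ≤
        (univ.filter fun w : Fin (L + L') → Bool => ringWinU c y w = false).card := by
    rw [← card_image_of_injective _ hinj]
    refine card_le_card fun w hw => ?_
    rw [mem_image] at hw
    obtain ⟨p, hp, rfl⟩ := hw
    rw [mem_filter] at hp ⊢
    exact ⟨mem_univ _, by rw [ringWinU_append]; exact hp.2⟩
  exact_mod_cast hle

end Summit.QuantumAdvantage.AdviceFreeQNC0

end
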